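/-
Copyright (c) 2026 the pub-hodgecm-mathlib formalisation cell (harness21).  Prover seat hodgecm-mathlib-K2Liu-p11 (g2), Track B «K2-LIT»,
#184♮ = hLiu418 = `stmt-HodgeConjecture-24832`; organ S2, σ8 S2-⊗ FILE 2c (group half, generic transport; LEAD F0P6-plan (g14) BATCH #14 (2), σ15).
THEOREMS ONLY (no `def`, no `instance`, no notation, no named-fact hypothesis, no `sorry`).
-/
import Summits.HodgeConjecture.HodgeConjecture.Theorems.K2LiuPiGroupSiegelSliceSpaces   -- ★ S2-⊗ FILE 2b (this seat): `exists_sum_prod_continuous`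
import HarnessLib

/-!
# Crux `HLiu418`, S2-⊗ FILE 2c (group half, generic): TRANSPORT OF THE SUM-OF-PRODUCTS DECOMPOSITION ALONG A GROUP ISOMORPHISM `Φ : H ≃* Π i, G i`
# — the shape in which `H = U(J)(L⁺ ⊗ ℝ)` (★ `archPiEquivCM : arch ≃ₜ* Π_w archLocal w`) consumes ★ FILE 2b

Cell `hodgecm-mathlib`, crux item hLiu418 = `stmt-HodgeConjecture-24832` (helper lane `--supports`, count-neutral).

For a group `H` with an isomorphism `Φ : H ≃* Π i, G i` onto a finite product (instance: ★ `archPiEquivCM`), one-factor embeddings `ι_i := Φ.symm ∘ Pi.mulSingle i`,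
a function `A : H → ℂ` in a finite-dimensional space `V` of functions on `H` (BINDER (F): `V` right-stable under `ι_i(K i)`; BINDER (L): every `B ∈ V` obeys the
one-factor left laws `B (ι_i p · h) = c i p · B h`, `p ∈ P i`, ARBITRARY `c i`; BINDER (I): `G i = P i · K i`): **`A h = Σ_r c_r · ∏_i b_{r,i} (Φ h i)`** with every
`b_{r,i} : G i → ℂ` obeying the factor-`i` law, `K i`-finite (its right `K i`-translates lie in the finite-dimensional transported slice space), and continuous when
`V` consists of continuous functions and `Φ.symm` is continuous (`exists_sum_prod_comp`, `exists_sum_prod_comp_continuous`).  Mechanism: ★ FILE 2b applied to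
`A ∘ Φ.symm` and `V.map (· ∘ Φ.symm)`.
References: [BorelJacquet1979, §4.1]; [Flath1979, §2]; [GanQiuTakeda2014, §5.6].
HONEST LABEL: HC_CM is proved only modulo the 7 printed citations (2 remaining named inputs: hLiu418 = stmt-HodgeConjecture-24832,
h413 = stmt-HodgeConjecture-24833) until rung 0 closes; count-neutral helper, closes no socket.
-/

set_option autoImplicit false
set_option linter.dupNamespace false

noncomputable section

namespace Summit.HodgeConjecture.HodgeConjecture.Cruxes.HLiu418.K2LiuPiGroupSiegelSliceTransport

open Summit.HodgeConjecture.HodgeConjecture.Cruxes.HLiu418.K2LiuPiGroupSiegelSliceSpaces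

variable {ι : Type*} [Fintype ι] [DecidableEq ι] {G : ι → Type*} [∀ i, Group (G i)] {H : Type*} [Group H]

omit [Fintype ι] [DecidableEq ι] in
/-- Precomposition with `Φ.symm` carries a finite-dimensional space of functions on `H` to a finite-dimensional space of functions on `Π i, G i`. [folklore] -/
theorem finiteDimensional_map_comp (Φ : H ≃* (Π i, G i)) (V : Submodule ℂ (H → ℂ)) [FiniteDimensional ℂ V] :
    FiniteDimensional ℂ (V.map (LinearMap.funLeft ℂ ℂ (Φ.symm : (Π i, G i) → H))) :=
  Module.Finite.map _ _

/-- **SUM-OF-PRODUCTS DECOMPOSITION ON `H` ALONG `Φ : H ≃* Π i, G i`.**  See the module docstring; the factor-`i` law, `K i`-finiteness (as right-`K i`-stability inside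
a finite-dimensional space of functions on `G i`) and the formula `A h = Σ_r c_r ∏_i b_{r,i}(Φ h i)`. [BorelJacquet1979, §4.1] [Flath1979, §2] -/
theorem exists_sum_prod_comp (Φ : H ≃* (Π i, G i)) (V : Submodule ℂ (H → ℂ)) [FiniteDimensional ℂ V] (P K : ∀ i, Set (G i)) (c : ∀ i, G i → ℂ)
    (hV : ∀ i, ∀ k ∈ K i, ∀ B ∈ V, (fun h => B (h * Φ.symm (Pi.mulSingle i k))) ∈ V)
    (hVlaw : ∀ B ∈ V, ∀ i, ∀ p ∈ P i, ∀ h : H, B (Φ.symm (Pi.mulSingle i p) * h) = c i p * B h)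
    (hI : ∀ i, ∀ g : G i, ∃ p ∈ P i, ∃ k ∈ K i, g = p * k) {A : H → ℂ} (hA : A ∈ V) :
    ∃ (m : ℕ) (cr : Fin m → ℂ) (b : Fin m → ∀ i, (G i → ℂ)) (S : ∀ i, Submodule ℂ (G i → ℂ)),
      (∀ i, FiniteDimensional ℂ (S i)) ∧ (∀ r i, b r i ∈ S i) ∧ (∀ i, ∀ f ∈ S i, ∀ k ∈ K i, (fun u => f (u * k)) ∈ S i) ∧
      (∀ r i, ∀ p ∈ P i, ∀ u, b r i (p * u) = c i p * b r i u) ∧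
      ∀ h, A h = ∑ r, cr r * ∏ i, b r i (Φ h i) := by
  classical
  -- transport to the product group
  set V' : Submodule ℂ ((Π i, G i) → ℂ) := V.map (LinearMap.funLeft ℂ ℂ (Φ.symm : (Π i, G i) → H)) with hV'
  haveI : FiniteDimensional ℂ V' := finiteDimensional_map_comp Φ V
  have hmem : ∀ {B : H → ℂ}, B ∈ V → (fun g : Π i, G i => B (Φ.symm g)) ∈ V' := fun {B} hB =>
    Submodule.mem_map.2 ⟨B, hB, rfl⟩
  have hmem' : ∀ {C : (Π i, G i) → ℂ}, C ∈ V' → ∃ B ∈ V, C = fun g => B (Φ.symm g) := fun {C} hC => by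
    obtain ⟨B, hB, rfl⟩ := Submodule.mem_map.1 hC
    exact ⟨B, hB, rfl⟩
  have hV'stab : ∀ i, ∀ k ∈ K i, ∀ C ∈ V', (fun g => C (g * Pi.mulSingle i k)) ∈ V' := by
    intro i k hk C hC
    obtain ⟨B, hB, rfl⟩ := hmem' hC
    have h := hmem (hV i k hk B hB)
    refine (congrArg (· ∈ V') ?_).mp h
    funext g
    simp only [map_mul]
  have hV'law : ∀ C ∈ V', ∀ i, ∀ p ∈ P i, ∀ g : Π i, G i, C (Pi.mulSingle i p * g) = c i p * C g := by
    intro C hC i p hp g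
    obtain ⟨B, hB, rfl⟩ := hmem' hC
    show B (Φ.symm (Pi.mulSingle i p * g)) = c i p * B (Φ.symm g)
    rw [map_mul, hVlaw B hB i p hp]
  obtain ⟨m, cr, b, hlaw, htr, hbS, hsum⟩ := exists_sum_prod V' P K c hV'stab hV'law hI (hmem hA)
  refine ⟨m, cr, b, fun i => Submodule.span ℂ {f : G i → ℂ | ∃ B ∈ V', ∃ x : Π i, G i, x i = 1 ∧ f = fun u => B (x * Pi.mulSingle i u)},
    fun i => finiteDimensional_span_slices V' i (P i) (K i) (c i) (hV'stab i) (fun B hB p hp g => hV'law B hB i p hp g) (hI i), hbS,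
    fun i f hf k hk => translate_mem_span V' i (K i) (hV'stab i) hf hk, hlaw, fun h => ?_⟩
  have h1 := hsum (Φ h)
  simp only [MulEquiv.symm_apply_apply] at h1
  exact h1

/-- **WITH CONTINUITY**: topological factors with continuous multiplication, `Φ.symm` continuous and `V` consisting of continuous functions ⇒ all factors `b r i` are continuous.
[BorelJacquet1979, §4.1] -/
theorem exists_sum_prod_comp_continuous [∀ i, TopologicalSpace (G i)] [∀ i, ContinuousMul (G i)] [TopologicalSpace H] (Φ : H ≃* (Π i, G i))
    (hΦ : Continuous (Φ.symm : (Π i, G i) → H)) (V : Submodule ℂ (H → ℂ)) [FiniteDimensional ℂ V] (P K : ∀ i, Set (G i)) (c : ∀ i, G i → ℂ)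
    (hV : ∀ i, ∀ k ∈ K i, ∀ B ∈ V, (fun h => B (h * Φ.symm (Pi.mulSingle i k))) ∈ V)
    (hVlaw : ∀ B ∈ V, ∀ i, ∀ p ∈ P i, ∀ h : H, B (Φ.symm (Pi.mulSingle i p) * h) = c i p * B h)
    (hI : ∀ i, ∀ g : G i, ∃ p ∈ P i, ∃ k ∈ K i, g = p * k) (hVc : ∀ B ∈ V, Continuous B) {A : H → ℂ} (hA : A ∈ V) :
    ∃ (m : ℕ) (cr : Fin m → ℂ) (b : Fin m → ∀ i, (G i → ℂ)) (S : ∀ i, Submodule ℂ (G i → ℂ)),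
      (∀ i, FiniteDimensional ℂ (S i)) ∧ (∀ r i, b r i ∈ S i) ∧ (∀ i, ∀ f ∈ S i, ∀ k ∈ K i, (fun u => f (u * k)) ∈ S i) ∧
      (∀ r i, ∀ p ∈ P i, ∀ u, b r i (p * u) = c i p * b r i u) ∧ (∀ r i, Continuous (b r i)) ∧
      ∀ h, A h = ∑ r, cr r * ∏ i, b r i (Φ h i) := by
  classical
  set V' : Submodule ℂ ((Π i, G i) → ℂ) := V.map (LinearMap.funLeft ℂ ℂ (Φ.symm : (Π i, G i) → H)) with hV'
  haveI : FiniteDimensional ℂ V' := finiteDimensional_map_comp Φ V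
  have hmem : ∀ {B : H → ℂ}, B ∈ V → (fun g : Π i, G i => B (Φ.symm g)) ∈ V' := fun {B} hB =>
    Submodule.mem_map.2 ⟨B, hB, rfl⟩
  have hmem' : ∀ {C : (Π i, G i) → ℂ}, C ∈ V' → ∃ B ∈ V, C = fun g => B (Φ.symm g) := fun {C} hC => by
    obtain ⟨B, hB, rfl⟩ := Submodule.mem_map.1 hC
    exact ⟨B, hB, rfl⟩
  have hV'stab : ∀ i, ∀ k ∈ K i, ∀ C ∈ V', (fun g => C (g * Pi.mulSingle i k)) ∈ V' := by
    intro i k hk C hC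
    obtain ⟨B, hB, rfl⟩ := hmem' hC
    have h := hmem (hV i k hk B hB)
    refine (congrArg (· ∈ V') ?_).mp h
    funext g
    simp only [map_mul]
  have hV'law : ∀ C ∈ V', ∀ i, ∀ p ∈ P i, ∀ g : Π i, G i, C (Pi.mulSingle i p * g) = c i p * C g := by
    intro C hC i p hp g
    obtain ⟨B, hB, rfl⟩ := hmem' hC
    show B (Φ.symm (Pi.mulSingle i p * g)) = c i p * B (Φ.symm g)
    rw [map_mul, hVlaw B hB i p hp]
  have hV'c : ∀ C ∈ V', Continuous C := by
    intro C hC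
    obtain ⟨B, hB, rfl⟩ := hmem' hC
    exact (hVc B hB).comp hΦ
  obtain ⟨m, cr, b, hlaw, htr, hbS, hsum⟩ := exists_sum_prod V' P K c hV'stab hV'law hI (hmem hA)
  refine ⟨m, cr, b, fun i => Submodule.span ℂ {f : G i → ℂ | ∃ B ∈ V', ∃ x : Π i, G i, x i = 1 ∧ f = fun u => B (x * Pi.mulSingle i u)},
    fun i => finiteDimensional_span_slices V' i (P i) (K i) (c i) (hV'stab i) (fun B hB p hp g => hV'law B hB i p hp g) (hI i), hbS,
    fun i f hf k hk => translate_mem_span V' i (K i) (hV'stab i) hf hk, hlaw, fun r i => continuous_of_mem_span V' i hV'c (hbS r i), fun h => ?_⟩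
  have h1 := hsum (Φ h)
  simp only [MulEquiv.symm_apply_apply] at h1
  exact h1

end Summit.HodgeConjecture.HodgeConjecture.Cruxes.HLiu418.K2LiuPiGroupSiegelSliceTransport

end
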